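import Mathlib

/-!
# SoloInformedUnitSymbolParity — the two elementary lemmas behind Part II §7.11 (8′)

Part II §7.11 uses, for a CYCLIC cubic field `F = ℚ(α)` with Galois group `C₃ = ⟨σ⟩` and a prime
`p ≠ 3`, two facts about the `C₃`-module `M = K₂(O_F) ⊗ ℤ_p` (on which the norm `1 + σ + σ²`
acts as zero, because it factors through `K₂(ℤ) ⊗ ℤ_p = 0`):

* (1) `M` has no non-zero `σ`-fixed vector; hence the `σ`-invariant Steinberg symbol
  `{ε, ε^σ}` of the fundamental units is `p`-divisible (the cyclic fields are CONTROLS for the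
  rigidity test of §7.11 (9)).
* (2) if moreover `p ≡ 2 (mod 3)`, then `dim_{𝔽_p} M/p` is EVEN (so `rk_p K₂(O_F) = 1` never
  happens for cyclic cubic `F` at such `p`; verified numerically for all 115 cyclic cubic fields
  of conductor ≤ 691 at `p = 5`, kit job j146126).

Both are statements of pure linear algebra about an endomorphism `σ` with `σ² + σ + 1 = 0`,
and that is what is proved here, with no number theory:

* `soloInformed_fixed_eq_zero_of_norm_eq_zero` : `x + σ x + σ (σ x) = 0` for all `x`, no `3`-torsion,
  `σ x = x` ⟹ `x = 0`.
* `soloInformed_sq_add_self_add_one_ne_zero` : for `p` prime with `p % 3 = 2`, `a² + a + 1 ≠ 0` in `ZMod p`.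
* `soloInformed_even_finrank_of_sq_add_self_add_one` : a finite-dimensional `𝔽_p`-space (`p % 3 = 2`)
  carrying a linear `σ` with `σ * σ + σ + 1 = 0` has even dimension — it is a vector space over
  the field `𝔽_p[X]/(X² + X + 1)` of degree `2`, and the tower law applies.
-/

namespace Summit.Langlands.Langlands.Theorems

open Polynomial

/-- (1) No fixed vectors: if the "norm" `1 + σ + σ²` is zero on `M` and `M` has no `3`-torsion,
then every `σ`-fixed element of `M` is zero. -/
theorem soloInformed_fixed_eq_zero_of_norm_eq_zero {M : Type*} [AddCommGroup M] (σ : M →+ M)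
    (hnorm : ∀ x, x + σ x + σ (σ x) = 0) (h3 : ∀ x : M, (3 : ℕ) • x = 0 → x = 0)
    {x : M} (hx : σ x = x) : x = 0 := by
  apply h3
  have h := hnorm x
  rw [hx, hx] at h
  calc (3 : ℕ) • x = x + x + x := by
        rw [show (3 : ℕ) = 2 + 1 from rfl, add_nsmul, two_nsmul, one_nsmul]
    _ = 0 := h

/-- `X² + X + 1` has no root modulo a prime `p ≡ 2 (mod 3)`: a root would be an element of
order `3` in `(ZMod p)ˣ`, forcing `3 ∣ p - 1`. -/
theorem soloInformed_sq_add_self_add_one_ne_zero {p : ℕ} [hp : Fact p.Prime] (hp3 : p % 3 = 2)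
    (a : ZMod p) : a ^ 2 + a + 1 ≠ 0 := by
  intro h
  have ha3 : a ^ 3 = 1 := by
    have : a ^ 3 - 1 = (a - 1) * (a ^ 2 + a + 1) := by ring
    rwa [h, mul_zero, sub_eq_zero] at this
  have ha1 : a ≠ 1 := by
    intro ha
    rw [ha] at h
    have h3 : ((3 : ℕ) : ZMod p) = 0 := by
      have : (1 : ZMod p) ^ 2 + 1 + 1 = ((3 : ℕ) : ZMod p) := by norm_num
      rw [← this]; exact h
    rw [ZMod.natCast_eq_zero_iff] at h3
    have : p = 1 ∨ p = 3 := by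
      rcases (Nat.dvd_prime Nat.prime_three).mp h3 with h1 | h1 <;> simp [h1]
    rcases this with h1 | h1
    · exact hp.out.one_lt.ne' h1
    · rw [h1] at hp3; simp at hp3
  have ha0 : a ≠ 0 := by
    rintro rfl
    simp at ha3
  have hord : orderOf a = 3 := orderOf_eq_prime ha3 ha1
  have hdvd : orderOf a ∣ p - 1 := orderOf_dvd_of_pow_eq_one (ZMod.pow_card_sub_one_eq_one ha0)
  rw [hord] at hdvd
  have h1 : 1 ≤ p := hp.out.one_lt.le
  omega

/-- (2) Even dimension: a finite-dimensional `𝔽_p`-vector space, `p ≡ 2 (mod 3)`, with a linear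
endomorphism `σ` satisfying `σ² + σ + 1 = 0` has even dimension. -/
theorem soloInformed_even_finrank_of_sq_add_self_add_one {p : ℕ} [hp : Fact p.Prime] (hp3 : p % 3 = 2)
    {V : Type*} [AddCommGroup V] [Module (ZMod p) V]
    (σ : V →ₗ[ZMod p] V) (hσ : σ * σ + σ + 1 = 0) :
    Even (Module.finrank (ZMod p) V) := by
  classical
  let f : (ZMod p)[X] := X ^ 2 + X + 1
  have hf2 : f.natDegree = 2 := by
    simp only [f]
    compute_degree!
  have hf0 : f ≠ 0 := by
    intro h0
    rw [h0, natDegree_zero] at hf2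
    exact absurd hf2 (by norm_num)
  have hirr : Irreducible f := by
    apply Polynomial.irreducible_of_degree_le_three_of_not_isRoot
    · rw [hf2]; decide
    · intro a ha
      apply soloInformed_sq_add_self_add_one_ne_zero hp3 a
      simpa [f, IsRoot] using ha
  haveI : Fact (Irreducible f) := ⟨hirr⟩
  have hfσ : Polynomial.aeval σ f = 0 := by
    simp only [f, map_add, map_pow, aeval_X, map_one]
    rwa [pow_two]
  -- the ring map `𝔽_p[X]/(f) → End(V)`, `X ↦ σ`
  let φ : AdjoinRoot f →+* Module.End (ZMod p) V :=
    Ideal.Quotient.lift (Ideal.span {f}) (Polynomial.aeval σ).toRingHom (by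
      intro a ha
      obtain ⟨q, rfl⟩ := Ideal.mem_span_singleton.mp ha
      simp [hfσ])
  have hφof : ∀ c : ZMod p, φ (AdjoinRoot.of f c) = algebraMap (ZMod p) (Module.End (ZMod p) V) c := by
    intro c
    show Ideal.Quotient.lift (Ideal.span {f}) (Polynomial.aeval σ).toRingHom _
      (Ideal.Quotient.mk (Ideal.span {f}) (C c)) = _
    rw [Ideal.Quotient.lift_mk]
    simp [Polynomial.aeval_C]
  letI : Module (AdjoinRoot f) V := Module.compHom V φ
  haveI : IsScalarTower (ZMod p) (AdjoinRoot f) V := by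
    constructor
    intro c k v
    change φ (c • k) v = c • (φ k v)
    rw [Algebra.smul_def, map_mul, AdjoinRoot.algebraMap_eq, hφof]
    rfl
  have hK : Module.finrank (ZMod p) (AdjoinRoot f) = 2 := by
    rw [(AdjoinRoot.powerBasis hf0).finrank, AdjoinRoot.powerBasis_dim, hf2]
  have htower := Module.finrank_mul_finrank (ZMod p) (AdjoinRoot f) V
  rw [hK] at htower
  exact ⟨Module.finrank (AdjoinRoot f) V, by omega⟩

end Summit.Langlands.Langlands.Theorems
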